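import Literature.NumberTheory.Automorphic.Sweep1
import Literature.NumberTheory.Automorphic.UnramifiedHeckeLevel
import HarnessLib

/-!
# Symmetric power functoriality (lang.S24): weak symmetric power lifts, the Newton–Thorne
theorem as a named fact, and the reduction of `Literature.NumberTheory.Automorphic.exists_cuspidal_symmetricPower`

Sibling file of `Literature.NumberTheory.Automorphic.Sweep1` (namespace `Literature.Lang`), landed by
the tenured seat of the named fact `Literature.NumberTheory.Automorphic.exists_cuspidal_symmetricPower` (**lang.S24**;
Newton–Thorne, *Symmetric power functoriality for holomorphic modular forms, II*, Publ. Math.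
IHÉS 134 (2021), Thm. A). That fact transcribes the theorem for a non-CM newform
`f ∈ S_k(Γ₁(N))`, `k ≥ 2`, and `m ≥ 1`: a cuspidal `Π ≤ L²_cusp(GL_{m+1}(ℚ)\GL_{m+1}(𝔸)/A_G)`
whose Satake parameters at almost all `p` are `{αⁱ β^{m-i} : 0 ≤ i ≤ m}` for `{α, β}` the
unitary Satake pair of `f` at `p` (`α + β = a_p(f) p^{-(k-1)/2}`, `αβ = χ_f(p)`). The printed
theorem (Thm. A = Thm. 3.1 of the source) is about the regular algebraic cuspidal automorphic
representation `π` of `GL₂(𝔸_ℚ)` attached to `f`, and its proof — a new automorphy lifting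
theorem for symmetric power representations (Thm. 2.1: the morphism `P → R` from a universal
pseudodeformation ring to a universal deformation ring, Taylor–Wiles–Kisin patching, regularity
of `Spec P` from [NT20]) combined with 'killing ramification' (§3), on top of part I (analytic
continuation of symmetric power functoriality along the Coleman–Mazur eigencurve, level-raising
congruences for unitary groups, the endoscopic classification) — has no carrier in Mathlib or
in `Literature` (no Galois deformation theory, no eigenvarieties, no automorphic forms on
unitary groups, no local Langlands correspondence, not even the automorphic representation of a
newform). So the fact is **not discharged** here; this file lands the honest first layer, in
the pattern of `Sweep1Proofs` (lang.S23) and `Sweep1PotentialModularity` (lang.S28):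

* `symmPowerParams m a b = {aⁱ b^{m-i} : 0 ≤ i ≤ m}` (**definition**: the Langlands class of
  the `m`-th symmetric power of an unramified representation of `GL₂` with Satake pair
  `{a, b}`), with `card = m + 1`, symmetry in `a, b` (`symmPowerParams_comm`; hence it only
  depends on the multiset `{a, b}`, `symmPowerParams_eq_of_pair_eq`), `Sym⁰ = {1}`,
  `Sym¹ = {a, b}`, and `∏ = (ab)^{m(m+1)/2}` (`prod_symmPowerParams`, the central character of
  the lift); all proved.
* `IsWeakSymmPowerLift m W W'` (**definition**; source, §1, first paragraph, p. 117: `Symᵐ π`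
  is "characterized by the requirement that for any place `v` of `F`, the Langlands parameter
  of `(Symᵐ π)_v` is the image of the Langlands parameter of `π_v` under the `m`th symmetric
  power `Symᵐ : GL₂ → GL_{m+1}`", read at the unramified places, for all but finitely many of
  them): for every pair of levels `𝔫, 𝔑 ⊆ 𝓞 K` and all but finitely many finite places `v`, a
  Satake parameter `{a, b}` of `W ≤ L²(GL₂(𝔸_K) ⧸ A_G GL₂(K))` at `v` (w.r.t. `K(𝔫)`) and a
  Satake parameter `β` of `W' ≤ L²(GL_{m+1}(𝔸_K) ⧸ A_G GL_{m+1}(K))` at `v` (w.r.t. `K(𝔑)`)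
  satisfy `β = symmPowerParams m a b`; verbatim the design of `IsWeakBaseChangeLift`
  (`Sweep1Proofs`). API (proved): `.eventually`, `.eventually_exists`; for cuspidal `W, W'` one
  pair of non-zero levels suffices (`isWeakSymmPowerLift_of_eventually_exists`, `_iff_`; from
  the level-independence of Satake parameters, `HasSatakeParameterAt.eq_of_ofLocal_eq_smul` of
  `UnramifiedHeckeLevel`, under the Flath fact of `UnramifiedHeckeScalars`); `Sym¹ π = π`
  (`isWeakSymmPowerLift_one_self`); uniqueness of a *cuspidal* weak `Symᵐ`-lift by strong
  multiplicity one (`IsWeakSymmPowerLift.unique`).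
* `IsAutomorphicRepOf f W` (**definition**, the dictionary newform ↦ automorphic representation
  on the tree's objects; Gelbart (1975), Thm. 5.19 with Lemma 5.16, (5.18); Bump (1997),
  Thm. 3.6.1): `W ≤ L²(GL₂(𝔸_ℚ) ⧸ A_G GL₂(ℚ))` has, with respect to one level `K(𝔫)`, `𝔫 ≠ 0`, at
  all but finitely many primes `p ∤ 𝔫` the Satake pair `{α, β}`, `α + β = a_p(f) p^{-(k-1)/2}`,
  `αβ = χ_f(p)` — literally the clause of `exists_cuspidal_symmetricPower` at `m = 1`.
* `Gelbart1975_exists_isAutomorphicRepOf` (**named fact**, Gelbart Thm. 5.19): a newform of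
  weight `k ≥ 2` on `Γ₁(N)` has a cuspidal automorphic representation in this sense.
* `NewtonThorne2021_exists_cuspidal_symmPowerLift` (**named fact**, source Thm. A): for `f` a
  non-CM newform of weight `k ≥ 2`, `P` cuspidal on `GL₂(𝔸_ℚ)` with `IsAutomorphicRepOf f P`
  and `m ≥ 1`, there is a cuspidal `Q` on `GL_{m+1}(𝔸_ℚ)` which is a weak `Symᵐ`-lift of `P`.
* `exists_cuspidal_symmetricPower_of_symmPowerLift` (**proved**, the assembly): the two named
  facts and "a cuspidal representation of `GL_{m+1}(𝔸_ℚ)` has Satake parameters with respect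
  to one level `K(𝔑)`, `𝔑 ≠ 0`, at all but finitely many places"
  (`Literature.NumberTheory.Automorphic.exists_hasSatakeParameterAt_cofinite`, Flath / Borel–Jacquet, a named fact
  of `GLnCuspidalSpectrum`, itself reduced to two smaller facts in `UnramifiedHeckeScalars`)
  imply `exists_cuspidal_symmetricPower`. So lang.S24 as stated in `Sweep1` rests on exactly
  one deep input, Thm. A of the source, plus the classical newform dictionary and Flath-level
  facts.
* Consistency checks (**proved**): the `m = 1` clause of `exists_cuspidal_symmetricPower` is
  the Gelbart fact alone (`exists_cuspidal_symmetricPower_one`); the `m = 1` instance of the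
  Newton–Thorne fact holds because `Sym¹ π = π` (`exists_cuspidal_symmPowerLift_one`); with
  strong multiplicity one the lift of the Newton–Thorne fact is unique
  (`existsUnique_cuspidal_symmPowerLift`: `Symᵐ π_f` is well defined inside `L²_cusp`).

## Source (read from the held copies: part II, published version, `paper:w3202254913`;
part I, arXiv text, `paper:arxiv-1912.11261`)

* Part II, Thm. A (p. 117): *Let `π` be a regular algebraic, cuspidal automorphic
  representation of `GL₂(𝔸_ℚ)`. Suppose that `π` is non-CM. Then for each integer `n ≥ 1`,
  `Symⁿ π` exists, as a regular algebraic, cuspidal automorphic representation of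
  `GL_{n+1}(𝔸_ℚ)`.* Restated as Thm. 3.1 (p. 139): *Let `n ≥ 1`. Let `π` be a regular
  algebraic, cuspidal automorphic representation of `GL₂(𝔸_ℚ)` which is non-CM. Then
  `Sym^{n-1} π` exists.*
* Part II, §1 (p. 117): "an automorphic representation `Symⁿ π` of `GL_{n+1}(𝔸_F)`,
  characterized by the requirement that for any place `v` of `F`, the Langlands parameter of
  `(Symⁿ π)_v` is the image of the Langlands parameter of `π_v` under the `n`th symmetric power
  `Symⁿ : GL₂ → GL_{n+1}` of the standard representation of `GL₂`"; and: `π` regular algebraic,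
  "in which case `π` corresponds to a twist of a cuspidal Hecke eigenform `f` of weight `k ≥ 2`,
  cf. [Gel75, §3]". Part I, Thm. 2, footnote: `π` "does not have CM. In other words, there is
  no quadratic Hecke character `χ` such that `π ≅ π ⊗ χ`."
* Part II, p. 118 and Appendix A, Thm. A.1: in the 'missing' cases (`π_∞` a holomorphic limit
  of discrete series, i.e. weight one, or `π` CM) `Symⁿ π` exists but "is usually not
  cuspidal" — whence the hypotheses `2 ≤ k` and `¬ IsCMForm f` of lang.S24.
* Proof architecture (recorded for tenure; nothing below Thm. A is formalisable on the present
  tree). Thm. 3.1 is proved by induction on `|sc(π)|`, the number of primes `p` with `π_p`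
  supercuspidal (§3, p. 139): the base case `sc(π) = ∅` is the main theorem of part I ([NT21];
  part I, Thm. 2: `π_l` not supercuspidal for every `l ∣ N`); the induction step is Prop. 3.10
  (remove one `p ∈ sc(π)`, `p ≥ 5`, through a congruence modulo `p`: Lemma 3.5, Prop. 3.7),
  which rests on the new automorphy lifting theorem, Thm. 2.1, for `Sym^{n-1} r_{π,ι}` over a
  totally real field (§2: the universal morphism `P → R` from the pseudodeformation ring of
  `Sym^{n-1} r̄_{π,ι}` to the deformation ring of `r̄_{π,ι}`, patched to `P_∞ → R_∞` by
  Taylor–Wiles–Kisin, `Spec P` regular at the relevant point by [NT20], `R_∞` a domain acting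
  faithfully on patched modular forms by [Kis09a, Kis09b]); Props. 3.9, 3.11 ('seasoned'
  representations, Def. 3.6, auxiliary primes `(q, t, r)`) and the proof of Thm. 3.1
  (pp. 147–148) use [Gee11, Cor. 3.1.7], [BLGGT14, Thm. 4.2.1], [KW09a, Lemma 6.3], Lemma 3.4
  (weight `k > 2` reduced to weight `2`) and potential diagonalizability [GK14, BLGG11]. Part I
  in turn: Thm. 4 (propagation of the automorphy of `Symⁿ` along irreducible components of the
  Coleman–Mazur eigencurve `𝓔₂`, Buzzard–Kilford's description of `𝓔₂` near the boundary of
  weight space, 'ping pong', §§2–3 there) and Thm. 5 (one level-one seed: level-raising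
  congruences via types for `U₃`/`U_n` and via the deformation theory of residually reducible
  representations [All19], Anastassiades' thesis `Sym^{n-1} ⇒ Sym^{2n-1}`), then 'killing
  ramification' with `n`-regularity (§8 there). Underneath: Galois representations of regular
  algebraic polarizable `π` with local–global compatibility, the endoscopic classification for
  unitary groups (part I, §1: Labesse, Mœglin, Kaletha), the local Langlands correspondence
  `rec`, eigenvarieties and trianguline representations, `p`-adic Hodge theory.

## Normalisations and faithfulness

* *Unitary twist.* Thm. A produces `Symᵐ π` for the regular algebraic `π` of `f`; the tree's
  `CuspidalAutomorphicRepGL n ℚ μ` are the unitary cuspidal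
  `Π ≤ L²_cusp(GL_n(ℚ)\GL_n(𝔸)/A_G)` (`A_G = ℝ_{>0}` central at infinity, outline D10). If
  `P ≅ π ⊗ |det|^{s}` is the unitary representation with `IsAutomorphicRepOf f P` (its Satake
  pairs are `p^{-s}` times those of `π`; by strong multiplicity one there is exactly one such
  `P`), then `Q = Symᵐ π ⊗ |det|^{ms}` is cuspidal automorphic with Satake parameters `Symᵐ` of
  those of `P` at every prime where both are unramified (the characterisation of §1 at
  unramified places; `Symᵐ(φ ⊗ χ) = Symᵐ φ ⊗ χᵐ`), and its central character
  `ω_Q = ω_P^{m(m+1)/2}` (cf. `prod_symmPowerParams`) is unitary and trivial on `A_G` because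
  `ω_P` is; a cuspidal representation with unitary central character is unitary, so `Q` is an
  irreducible closed subspace of the tree's `L²_cusp(GL_{m+1}(ℚ)\GL_{m+1}(𝔸)/A_G)`
  (Borel–Jacquet, Corvallis (1979), §4.6, as throughout `GLnCuspidalSpectrum`). Hence the named
  fact is Thm. A read on the tree's objects; "regular algebraic" itself (an `InfinityType` for
  `π_∞`) is not expressible on the tree (module docstring of `Sweep1`), and is replaced by its
  source-given equivalent "attached to a cuspidal Hecke eigenform of weight `k ≥ 2`" (p. 117).
* *Non-CM.* The source's "no quadratic Hecke character `χ` with `π ≅ π ⊗ χ`" is, for the `π`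
  of a newform `f`, Ribet's notion `IsCMForm f` of `Sweep1` (a Dirichlet character `η ≠ 1` with
  `η(p) a_p = a_p` for almost all `p`; Ribet, LNM 601 (1977), §3: such an `η` is the quadratic
  character of an imaginary quadratic field, and then `π_f ≅ π_f ⊗ η` by strong multiplicity
  one), so `¬ IsCMForm f` is the printed hypothesis.
* *The newform dictionary and Hecke conventions.* `HasSatakeParameterAt` (`GLnAdelicStructure`)
  reads the eigenvalues `q_v^{i(n-i)/2} e_i(α)` of the double-coset operators
  `T_{v,i} = [K t_{v,i} K] = ∑_{yK ⊆ K t_{v,i} K} R(y)`, `t_{v,i} = diag(ϖ,…,ϖ,1,…,1)`, for the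
  right regular representation `(R(g)φ)(x) = φ(xg)` (`AutomorphicSpectrum.rightRegular`,
  `HeckeAlgebra.heckeOperator`); for `n = 2` these are Bump's `𝕋_p` and `ℝ_p = R(diag(ϖ, ϖ))`
  (Bump (1997), §3.6, p. 341, (6.7)). Bump's Thm. 3.6.1 and its proof (pp. 340–342: the
  adelisation `φ` of a Hecke eigenform `F` on `Γ₀(N)` with character `χ` is an eigenfunction of
  `𝕋_p` with the eigenvalue of the classical Hecke operator, and of `ℝ_p` with eigenvalue
  `χ(p)`, `p ∤ N`) give, for a newform `f` of weight `k` (whose avatar `F(g) = (f|_k g)(i)`,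
  Bump (2.14), has `T_p`-eigenvalue `p^{1-k/2} a_p(f)` in the weight-`k` slash normalisation),
  the Satake pair `{α, β}` of `π_f` at `p ∤ N`: `p^{1/2}(α + β) = p^{1-k/2} a_p`, `αβ = χ(p)`,
  i.e. exactly the clause of `IsAutomorphicRepOf` and of `Sweep1`. Gelbart (1975), Lemma 5.16,
  (5.18) (`T(p) f = C_p f`, `C_p = p^{(k-1)/2}(p^{s₁} + p^{s₂})`, `μ₁μ₂ = ψ_p` for
  `π_p = π(μ₁, μ₂)`, `μ_i = |·|^{s_i}`) displays the inverse pair `{μ_i(p)⁻¹}` in his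
  parametrisation. Whatever dictionary is used, replacing `{α, β}` by `{α⁻¹, β⁻¹} = {ᾱ, β̄}`
  (`|α| = |β| = 1`) amounts to replacing `f` by the conjugate newform
  `f^ρ = ∑ conj(a_n) qⁿ ∈ S_k(N, χ̄)` (`a_p = χ(p) conj(a_p)` for `p ∤ N`), and `f ↦ f^ρ`
  preserves newforms, non-CM newforms and the shape of every statement below; so the
  existence statements `Gelbart1975_exists_isAutomorphicRepOf`,
  `NewtonThorne2021_exists_cuspidal_symmPowerLift` and `exists_cuspidal_symmetricPower` hold
  verbatim under either reading, and nothing in this file depends on resolving it.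
* `IsWeakSymmPowerLift` quantifies over all pairs of levels before the cofinite filter,
  exactly as `IsWeakBaseChangeLift` (the finitely many `v ∣ 𝔫𝔑`, where `K(𝔫)`, `K(𝔑)` are not
  maximal and `HasSatakeParameterAt` reads `U`- rather than `T`-eigenvalues, depend on the
  levels); at `v ∤ 𝔫` a `K(𝔫)`-fixed Hecke eigenvector of a cuspidal `W` exhibits the genuine
  Hecke matrix `t_{W,v}` (`Flath1979_heckeOperatorAt_ofLocal_eq_smul`,
  `HasSatakeParameterAt.eq_of_ofLocal_eq_smul`), so for cuspidal `W, W'` the definition says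
  "`t_{W',v} = Symᵐ t_{W,v}` for almost all `v`" (`isWeakSymmPowerLift_iff_eventually_exists`);
  for a `W` admitting no Satake parameters at any level it holds vacuously (documented junk
  case, never met by cuspidal `W`, `exists_hasSatakeParameterAt_cofinite`).
* Generality: `symmPowerParams`, `IsWeakSymmPowerLift` and their API are stated over any
  number field `K` (the characterisation of §1 of the source is for `GL₂(𝔸_F)`, `F` a number
  field); the newform dictionary and the two named facts are over `ℚ`, as printed. Automorphic
  measures are quantified as in `Sweep1` (`∀ μ [IsAutomorphicMeasure μ]` in hypotheses, `∃ ν`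
  in conclusions). No new instances.

## References

* J. Newton, J. A. Thorne, *Symmetric power functoriality for holomorphic modular forms, II*,
  Publ. Math. IHÉS 134 (2021), 117–152: §1 (p. 117), Thm. A, Cor. B, Thm. 2.1, §3 (Thm. 3.1,
  Def. 3.2, Lemmas 3.3–3.5, Def. 3.6, Props. 3.7–3.11), Appendix A, Thm. A.1
  [NewtonThorneIHES2021b].
* J. Newton, J. A. Thorne, *Symmetric power functoriality for holomorphic modular forms*,
  Publ. Math. IHÉS 134 (2021), 1–116: Thms. 1, 2 (with the footnote defining non-CM), 4, 5
  [NewtonThorneIHES2021a].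
* S. Gelbart, *Automorphic forms on adele groups*, Ann. of Math. Stud. 83 (1975), §5:
  Thm. 5.14, Lemma 5.16 with (5.17)–(5.18), Thm. 5.19 [Gelbart1975].
* D. Bump, *Automorphic forms and representations* (1997), §3.6, (6.1)–(6.7), Thm. 3.6.1 and
  its proof (pp. 338–342) [Bump1997].
* K. Ribet, *Galois representations attached to eigenforms with Nebentypus*, LNM 601 (1977),
  §3 [Ribet1977].
* D. Flath, *Decomposition of representations into tensor products*, Corvallis (1979), Thm. 3
  [FlathCorvallis1979]; P. Cartier, *Representations of 𝔭-adic groups*, Corvallis (1979), §IV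
  [CartierCorvallis1979].
-/

noncomputable section

open scoped MatrixGroups
open NumberField IsDedekindDomain MeasureTheory Filter

namespace Literature.NumberTheory.Automorphic

open EllipticCurves.ModularForms

/-! ### The symmetric power of a pair of Satake parameters -/

section SymmPower

/-- **Satake parameters of a symmetric power.** For `a, b ∈ ℂ` and `m : ℕ`, the multiset
`symmPowerParams m a b = {aⁱ b^{m-i} : 0 ≤ i ≤ m}` of the `m + 1` eigenvalues of
`Symᵐ diag(a, b) ∈ GL_{m+1}(ℂ)`: the Langlands (Satake) class of the `m`-th symmetric power of
the unramified representation of `GL₂(K_v)` with Satake pair `{a, b}` — "the image of the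
Langlands parameter of `π_v` under the `m`th symmetric power `Symᵐ : GL₂ → GL_{m+1}` of the
standard representation of `GL₂`" (Newton–Thorne II, §1, p. 117), at an unramified place. It
is symmetric in `a, b` (`symmPowerParams_comm`), hence a function of the multiset `{a, b}`
(`symmPowerParams_eq_of_pair_eq`). The `ℕ`-subtraction `m - i` only occurs for `i ≤ m`; the
expression is syntactically the one of `exists_cuspidal_symmetricPower` (`Sweep1`).
[cite: NewtonThorneIHES2021b, §1 (p. 117)] -/
def symmPowerParams (m : ℕ) (a b : ℂ) : Multiset ℂ :=
  (Multiset.range (m + 1)).map fun i => a ^ i * b ^ (m - i)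

/-- Unfolding of `symmPowerParams` (definitional). [folklore] -/
theorem symmPowerParams_def (m : ℕ) (a b : ℂ) :
    symmPowerParams m a b = (Multiset.range (m + 1)).map fun i => a ^ i * b ^ (m - i) :=
  rfl

/-- `Symᵐ` of a `2`-dimensional class has `m + 1` eigenvalues. [folklore] -/
@[simp]
theorem card_symmPowerParams (m : ℕ) (a b : ℂ) :
    Multiset.card (symmPowerParams m a b) = m + 1 := by
  rw [symmPowerParams, Multiset.card_map, Multiset.card_range]

/-- Membership in `symmPowerParams m a b`: the elements are the `aⁱ b^{m-i}`, `i ≤ m`.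
[folklore] -/
theorem mem_symmPowerParams {m : ℕ} {a b z : ℂ} :
    z ∈ symmPowerParams m a b ↔ ∃ i ≤ m, a ^ i * b ^ (m - i) = z := by
  simp only [symmPowerParams, Multiset.mem_map, Multiset.mem_range, Nat.lt_succ_iff]

/-- Reflection `j ↦ m - j` permutes `{0, …, m}`: as multisets,
`map (m - ·) (range (m + 1)) = range (m + 1)` (Mathlib `Finset.range_image_pred_top_sub`,
transported to `Multiset.range` through `Finset.image_val_of_injOn`). [folklore] -/
theorem range_add_one_map_sub (m : ℕ) :
    (Multiset.range (m + 1)).map (fun j => m - j) = Multiset.range (m + 1) := by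
  have h := Finset.range_image_pred_top_sub (m + 1)
  simp only [Nat.add_sub_cancel] at h
  have hinj : Set.InjOn (fun j => m - j) (Finset.range (m + 1) : Set ℕ) := by
    intro i hi j hj hij
    simp only [Finset.coe_range, Set.mem_Iio, Nat.lt_succ_iff] at hi hj
    simp only at hij
    omega
  rw [← Finset.range_val, ← Finset.image_val_of_injOn hinj, h]

/-- **`Symᵐ{a, b}` is symmetric in `a, b`**: `{aⁱ b^{m-i}} = {bⁱ a^{m-i}}` (reindex by
`i ↦ m - i`, `range_add_one_map_sub`). This is what makes the relation defining
`IsWeakSymmPowerLift` independent of the order in which a Satake pair `{a, b} = {b, a}` is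
written. [folklore] -/
theorem symmPowerParams_comm (m : ℕ) (a b : ℂ) :
    symmPowerParams m a b = symmPowerParams m b a := by
  conv_rhs => rw [symmPowerParams, ← range_add_one_map_sub m, Multiset.map_map]
  rw [symmPowerParams]
  refine Multiset.map_congr rfl fun i hi => ?_
  rw [Multiset.mem_range, Nat.lt_succ_iff] at hi
  simp only [Function.comp_apply, Nat.sub_sub_self hi, mul_comm]

/-- `Sym⁰{a, b} = {1}` (the trivial representation of `GL₁`). [folklore] -/
@[simp]
theorem symmPowerParams_zero (a b : ℂ) : symmPowerParams 0 a b = {1} := by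
  simp [symmPowerParams, Multiset.range_succ]

/-- `Sym¹{a, b} = {a, b}` (`Sym¹` is the standard representation). [folklore] -/
@[simp]
theorem symmPowerParams_one (a b : ℂ) : symmPowerParams 1 a b = {a, b} := by
  simp [symmPowerParams, Multiset.range_succ]

/-- `symmPowerParams m a b` only depends on the multiset `{a, b}`: if `{a, b} = {c, d}` then
`Symᵐ{a, b} = Symᵐ{c, d}` (either `(a, b) = (c, d)`, or `(a, b) = (d, c)` and
`symmPowerParams_comm`). [folklore] -/
theorem symmPowerParams_eq_of_pair_eq {m : ℕ} {a b c d : ℂ}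
    (h : ({a, b} : Multiset ℂ) = {c, d}) : symmPowerParams m a b = symmPowerParams m c d := by
  simp only [Multiset.insert_eq_cons, Multiset.cons_eq_cons, Multiset.singleton_inj,
    Multiset.singleton_eq_cons_iff, ne_eq] at h
  rcases h with ⟨rfl, rfl⟩ | ⟨-, cs, ⟨hb, -⟩, hd, -⟩
  · rfl
  · rw [← hb, hd]
    exact symmPowerParams_comm m a b

/-- **Determinant of a symmetric power**: `∏_{i=0}^{m} aⁱ b^{m-i} = (ab)^{m(m+1)/2}`, i.e.
`det Symᵐ = det^{m(m+1)/2}` on `GL₂`; for a weak `Symᵐ`-lift `Π` of `π` this is the relation of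
central characters `ω_Π(ϖ_v) = ω_π(ϖ_v)^{m(m+1)/2}` at the unramified places (`e_{m+1}` of the
Satake parameter is the eigenvalue of `T_{v,m+1} = R(ϖ_v · 1)`). Induction on `m`:
`Sym^{m+1}{a, b} = a^{m+1} ∷ (Symᵐ{a, b}) · b`. [folklore] -/
theorem prod_symmPowerParams (m : ℕ) (a b : ℂ) :
    (symmPowerParams m a b).prod = (a * b) ^ (m * (m + 1) / 2) := by
  induction m with
  | zero => simp
  | succ m ih =>
    have h1 : symmPowerParams (m + 1) a b =
        a ^ (m + 1) ::ₘ (symmPowerParams m a b).map (· * b) := by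
      rw [symmPowerParams, Multiset.range_succ, Multiset.map_cons, Nat.sub_self, pow_zero,
        mul_one, symmPowerParams, Multiset.map_map]
      congr 1
      refine Multiset.map_congr rfl fun i hi => ?_
      rw [Multiset.mem_range, Nat.lt_succ_iff] at hi
      rw [Function.comp_apply, Nat.succ_sub hi, pow_succ, mul_assoc]
    rw [h1, Multiset.prod_cons, Multiset.prod_map_mul, Multiset.map_id', ih, Multiset.map_const',
      Multiset.prod_replicate, card_symmPowerParams]
    have h2 : (m + 1) * (m + 1 + 1) / 2 = m * (m + 1) / 2 + (m + 1) := by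
      have : (m + 1) * (m + 1 + 1) = m * (m + 1) + 2 * (m + 1) := by ring
      rw [this, Nat.add_mul_div_left _ _ two_pos]
    rw [h2, pow_add, mul_pow]
    ring

end SymmPower

/-! ### Weak symmetric power lifts (Newton–Thorne II, §1) -/

section Lift

variable (m : ℕ) {K : Type} [Field K] [NumberField K]

section Def

variable {μ : Measure (AdelicGroupData.gl 2 K).automorphicQuotient}
  [SMulInvariantMeasure (AdelicGroupData.gl 2 K).Adelic
    (AdelicGroupData.gl 2 K).automorphicQuotient μ]
  {ν : Measure (AdelicGroupData.gl (m + 1) K).automorphicQuotient}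
  [SMulInvariantMeasure (AdelicGroupData.gl (m + 1) K).Adelic
    (AdelicGroupData.gl (m + 1) K).automorphicQuotient ν]

/-- **Weak `m`-th symmetric power lift** (Newton–Thorne, *Symmetric power functoriality for
holomorphic modular forms, II*, Publ. Math. IHÉS 134 (2021), §1, p. 117: the symmetric power
lifting `Symᵐ π` of a cuspidal `π` on `GL₂(𝔸_F)` is the automorphic representation of
`GL_{m+1}(𝔸_F)` "characterized by the requirement that for any place `v` of `F`, the Langlands
parameter of `(Symᵐ π)_v` is the image of the Langlands parameter of `π_v` under the `m`th
symmetric power `Symᵐ : GL₂ → GL_{m+1}` of the standard representation of `GL₂`", read at the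
unramified places and for all but finitely many of them). For a number field `K`, a closed
subrepresentation `W' ≤ L²(GL_{m+1}(𝔸_K) ⧸ A_G GL_{m+1}(K))` is a *weak `m`-th symmetric power
lift* of a closed subrepresentation `W ≤ L²(GL₂(𝔸_K) ⧸ A_G GL₂(K))` if for every pair of levels
`𝔫, 𝔑 ⊆ 𝓞 K` and all but finitely many finite places `v`, whenever `W` has Satake parameter
`{a, b}` at `v` with respect to the principal congruence subgroup `K(𝔫)` and `W'` has Satake
parameter `β` at `v` with respect to `K(𝔑)`, then `β = Symᵐ{a, b} = {aⁱ b^{m-i} : 0 ≤ i ≤ m}`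
(`symmPowerParams`; the unramified Langlands parameter of `W'_v` is `Symᵐ` of that of `W_v`).
A Satake parameter of `W` on `GL₂` is always a pair (`exists_pair_of_hasSatakeParameterAt`),
and the relation does not depend on how the pair is ordered (`symmPowerParams_eq_of_pair_eq`).
The levels are quantified before the cofinite filter because the finitely many `v ∣ 𝔫𝔑`
(where `K(𝔫)`, `K(𝔑)` are not maximal and `HasSatakeParameterAt` does not read spherical
eigenvalues) depend on them; at `v ∤ 𝔫`, `v ∤ 𝔑` the predicates read the genuine Hecke
matrices `t_{W,v}`, `t_{W',v}` (`isMaximalAt_principalCongruenceLevel`), so for cuspidal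
`W, W'` (which have Satake parameters at one level almost everywhere,
`exists_hasSatakeParameterAt_cofinite`) this says exactly "`t_{W',v} = Symᵐ t_{W,v}` for almost
all `v`" (`isWeakSymmPowerLift_iff_eventually_exists`); for a `W` admitting no Satake
parameters at any level it holds vacuously (junk case). Same design as `IsWeakBaseChangeLift`
(`Sweep1Proofs`). "Weak": the source's characterisation is at *all* places through the local
Langlands correspondence, not available on the tree; for cuspidal lifts the weak relation pins
`W'` down (`IsWeakSymmPowerLift.unique`). [cite: NewtonThorneIHES2021b, §1 (p. 117)] -/
def IsWeakSymmPowerLift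
    (W : ContRepresentation.ClosedSubrep ((AdelicGroupData.gl 2 K).rightRegular μ))
    (W' : ContRepresentation.ClosedSubrep ((AdelicGroupData.gl (m + 1) K).rightRegular ν)) :
    Prop :=
  ∀ (𝔫 𝔑 : Ideal (𝓞 K)),
    ∀ᶠ v : HeightOneSpectrum (𝓞 K) in cofinite,
      ∀ (ϖ ϖ' : (v.adicCompletion K)ˣ) (α β : Multiset ℂ),
        HasSatakeParameterAt W (principalCongruenceLevel 2 K 𝔫) v ϖ α →
          HasSatakeParameterAt W' (principalCongruenceLevel (m + 1) K 𝔑) v ϖ' β →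
            ∀ a b : ℂ, α = {a, b} → β = symmPowerParams m a b

variable {m}
variable {W : ContRepresentation.ClosedSubrep ((AdelicGroupData.gl 2 K).rightRegular μ)}
  {W' : ContRepresentation.ClosedSubrep ((AdelicGroupData.gl (m + 1) K).rightRegular ν)}

/-- The relation of a weak `Symᵐ`-lift at a fixed pair of levels `𝔫, 𝔑`: for all but finitely
many `v`, a Satake pair `{a, b}` of `W` at `v` (level `K(𝔫)`) and a Satake parameter `β` of `W'`
at `v` (level `K(𝔑)`) satisfy `β = Symᵐ{a, b}` (Newton–Thorne II, §1; definitional unfolding).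
[cite: NewtonThorneIHES2021b, §1 (p. 117)] -/
theorem IsWeakSymmPowerLift.eventually (h : IsWeakSymmPowerLift m W W') (𝔫 𝔑 : Ideal (𝓞 K)) :
    ∀ᶠ v : HeightOneSpectrum (𝓞 K) in cofinite,
      ∀ (ϖ ϖ' : (v.adicCompletion K)ˣ) (a b : ℂ) (β : Multiset ℂ),
        HasSatakeParameterAt W (principalCongruenceLevel 2 K 𝔫) v ϖ {a, b} →
          HasSatakeParameterAt W' (principalCongruenceLevel (m + 1) K 𝔑) v ϖ' β →
            β = symmPowerParams m a b := by
  filter_upwards [h 𝔫 𝔑] with v hv ϖ ϖ' a b β ha hβ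
  exact hv ϖ ϖ' {a, b} β ha hβ a b rfl

omit [SMulInvariantMeasure (AdelicGroupData.gl (m + 1) K).Adelic
    (AdelicGroupData.gl (m + 1) K).automorphicQuotient ν] in
/-- A Satake parameter on `GL₂` is a pair `{a, b}` (it has cardinality `2`,
`HasSatakeParameterAt.card_eq`; Mathlib `Multiset.card_eq_two`). [folklore] -/
theorem exists_pair_of_hasSatakeParameterAt {Kf : Subgroup (GL (Fin 2) (AdeleRing (𝓞 K) K))}
    {v : HeightOneSpectrum (𝓞 K)} {ϖ : (v.adicCompletion K)ˣ} {α : Multiset ℂ}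
    (h : HasSatakeParameterAt W Kf v ϖ α) : ∃ a b : ℂ, α = {a, b} :=
  Multiset.card_eq_two.mp h.card_eq

/-- **The lift relation in existential form.** If `W'` is a weak `Symᵐ`-lift of `W` and `W`,
`W'` *have* Satake parameters at the levels `K(𝔫)`, `K(𝔑)` at all but finitely many places,
then for all but finitely many `v` there are a Satake pair `{a, b}` of `W` at `v` (level
`K(𝔫)`) and the Satake parameter `Symᵐ{a, b}` of `W'` at `v` (level `K(𝔑)`):
`t_{W',v} = Symᵐ t_{W,v}` for almost all `v`, the characterisation of Newton–Thorne II, §1, at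
the unramified places, read at these levels. [cite: NewtonThorneIHES2021b, §1 (p. 117)] -/
theorem IsWeakSymmPowerLift.eventually_exists (h : IsWeakSymmPowerLift m W W')
    {𝔫 𝔑 : Ideal (𝓞 K)}
    (hW : ∀ᶠ v : HeightOneSpectrum (𝓞 K) in cofinite,
      ∃ (ϖ : (v.adicCompletion K)ˣ) (α : Multiset ℂ),
        HasSatakeParameterAt W (principalCongruenceLevel 2 K 𝔫) v ϖ α)
    (hW' : ∀ᶠ v : HeightOneSpectrum (𝓞 K) in cofinite,
      ∃ (ϖ' : (v.adicCompletion K)ˣ) (β : Multiset ℂ),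
        HasSatakeParameterAt W' (principalCongruenceLevel (m + 1) K 𝔑) v ϖ' β) :
    ∀ᶠ v : HeightOneSpectrum (𝓞 K) in cofinite,
      ∃ (ϖ ϖ' : (v.adicCompletion K)ˣ) (a b : ℂ),
        HasSatakeParameterAt W (principalCongruenceLevel 2 K 𝔫) v ϖ {a, b} ∧
          HasSatakeParameterAt W' (principalCongruenceLevel (m + 1) K 𝔑) v ϖ'
            (symmPowerParams m a b) := by
  filter_upwards [hW, hW', h 𝔫 𝔑] with v hv hv' hrel
  obtain ⟨ϖ, α, hα⟩ := hv
  obtain ⟨a, b, rfl⟩ := exists_pair_of_hasSatakeParameterAt hα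
  obtain ⟨ϖ', β, hβ⟩ := hv'
  obtain rfl := hrel ϖ ϖ' _ β hα hβ a b rfl
  exact ⟨ϖ, ϖ', a, b, hα, hβ⟩

end Def

/-! ### Cuspidal representations: one pair of levels suffices; `Sym¹ π = π` -/

section Cuspidal

variable {m}
variable {μ : Measure (AdelicGroupData.gl 2 K).automorphicQuotient}
  [(AdelicGroupData.gl 2 K).IsAutomorphicMeasure μ]
  {ν : Measure (AdelicGroupData.gl (m + 1) K).automorphicQuotient}
  [(AdelicGroupData.gl (m + 1) K).IsAutomorphicMeasure ν]

/-- **One pair of levels suffices for cuspidal representations.** Let `π` on `GL₂(𝔸_K)` and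
`Π` on `GL_{m+1}(𝔸_K)` be cuspidal, and assume the unramified local Hecke algebras act by
scalars on fixed vectors (`Flath1979_heckeOperatorAt_ofLocal_eq_smul` for `GL₂` and for
`GL_{m+1}`). If for ONE pair of non-zero levels `𝔫₀`, `𝔑₀` and all but finitely many `v` there
are a Satake pair `{a, b}` of `π` at `v` (level `K(𝔫₀)`) and the Satake parameter `Symᵐ{a, b}`
of `Π` at `v` (level `K(𝔑₀)`) — the characterisation of Newton–Thorne II, §1, at the
unramified places, read at these levels — then `Π` is a weak `Symᵐ`-lift of `π` in the sense of
`IsWeakSymmPowerLift` (the relation for ALL pairs of levels): Satake parameters of a cuspidal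
representation at `v` do not depend on the level `K(𝔫)`, `v ∤ 𝔫`
(`HasSatakeParameterAt.eq_of_ofLocal_eq_smul`; the junk level `0` is the level `𝓞 K`,
`exists_ne_zero_principalCongruenceLevel_eq`), a pair determines its symmetric power
(`symmPowerParams_eq_of_pair_eq`), and the finitely many `v ∣ 𝔫𝔫₀𝔑𝔑₀` are discarded.
[cite: NewtonThorneIHES2021b, §1 (p. 117)] -/
theorem isWeakSymmPowerLift_of_eventually_exists
    (hF₂ : Flath1979_heckeOperatorAt_ofLocal_eq_smul (n := 2) (K := K) (μ := μ))
    (hF : Flath1979_heckeOperatorAt_ofLocal_eq_smul (n := m + 1) (K := K) (μ := ν))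
    (P : CuspidalAutomorphicRepGL 2 K μ) (Q : CuspidalAutomorphicRepGL (m + 1) K ν)
    {𝔫₀ : Ideal (𝓞 K)} (h𝔫₀ : 𝔫₀ ≠ 0) {𝔑₀ : Ideal (𝓞 K)} (h𝔑₀ : 𝔑₀ ≠ 0)
    (h : ∀ᶠ v : HeightOneSpectrum (𝓞 K) in cofinite,
      ∃ (ϖ ϖ' : (v.adicCompletion K)ˣ) (a b : ℂ),
        HasSatakeParameterAt P.1 (principalCongruenceLevel 2 K 𝔫₀) v ϖ {a, b} ∧
          HasSatakeParameterAt Q.1 (principalCongruenceLevel (m + 1) K 𝔑₀) v ϖ'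
            (symmPowerParams m a b)) :
    IsWeakSymmPowerLift m P.1 Q.1 := by
  intro 𝔫 𝔑
  obtain ⟨𝔫₁, h𝔫₁, h𝔫K⟩ := exists_ne_zero_principalCongruenceLevel_eq (n := 2) 𝔫
  obtain ⟨𝔑₁, h𝔑₁, h𝔑K⟩ := exists_ne_zero_principalCongruenceLevel_eq (n := m + 1) 𝔑
  have h1 : ∀ᶠ v : HeightOneSpectrum (𝓞 K) in cofinite, ¬ v.asIdeal ∣ 𝔫₁ :=
    (Ideal.finite_factors h𝔫₁).compl_mem_cofinite
  have h2 : ∀ᶠ v : HeightOneSpectrum (𝓞 K) in cofinite, ¬ v.asIdeal ∣ 𝔫₀ :=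
    (Ideal.finite_factors h𝔫₀).compl_mem_cofinite
  have h3 : ∀ᶠ v : HeightOneSpectrum (𝓞 K) in cofinite, ¬ v.asIdeal ∣ 𝔑₁ :=
    (Ideal.finite_factors h𝔑₁).compl_mem_cofinite
  have h4 : ∀ᶠ v : HeightOneSpectrum (𝓞 K) in cofinite, ¬ v.asIdeal ∣ 𝔑₀ :=
    (Ideal.finite_factors h𝔑₀).compl_mem_cofinite
  filter_upwards [h1, h2, h3, h4, h] with v hv1 hv2 hv3 hv4 hv ϖ₁ ϖ₁' α₁ β₁ hα₁ hβ₁ a₁ b₁ hab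
  obtain ⟨ϖ, ϖ', a, b, hα, hβ⟩ := hv
  rw [h𝔫K] at hα₁
  rw [h𝔑K] at hβ₁
  rw [HasSatakeParameterAt.eq_of_ofLocal_eq_smul hF Q h𝔑₁ h𝔑₀ hv3 hv4 hβ₁ hβ]
  have e : ({a₁, b₁} : Multiset ℂ) = {a, b} :=
    hab ▸ HasSatakeParameterAt.eq_of_ofLocal_eq_smul hF₂ P h𝔫₁ h𝔫₀ hv1 hv2 hα₁ hα
  exact (symmPowerParams_eq_of_pair_eq e).symm

/-- **`IsWeakSymmPowerLift` is the characterisation of Newton–Thorne II, §1, at the unramified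
places, for cuspidal representations.** Under `Flath1979_heckeOperatorAt_ofLocal_eq_smul` for
`GL₂` and `GL_{m+1}`, for cuspidal `π`, `Π` having Satake parameters at the non-zero levels
`K(𝔫₀)`, `K(𝔑₀)` at all but finitely many places (as provided by
`exists_hasSatakeParameterAt_cofinite`), `Π` is a weak `Symᵐ`-lift of `π` iff
`t_{Π,v} = Symᵐ t_{π,v}` for all but finitely many `v`, the Hecke matrices being read at the
levels `K(𝔫₀)`, `K(𝔑₀)` (`IsWeakSymmPowerLift.eventually_exists`,
`isWeakSymmPowerLift_of_eventually_exists`). [cite: NewtonThorneIHES2021b, §1 (p. 117)] -/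
theorem isWeakSymmPowerLift_iff_eventually_exists
    (hF₂ : Flath1979_heckeOperatorAt_ofLocal_eq_smul (n := 2) (K := K) (μ := μ))
    (hF : Flath1979_heckeOperatorAt_ofLocal_eq_smul (n := m + 1) (K := K) (μ := ν))
    (P : CuspidalAutomorphicRepGL 2 K μ) (Q : CuspidalAutomorphicRepGL (m + 1) K ν)
    {𝔫₀ : Ideal (𝓞 K)} (h𝔫₀ : 𝔫₀ ≠ 0) {𝔑₀ : Ideal (𝓞 K)} (h𝔑₀ : 𝔑₀ ≠ 0)
    (hP : ∀ᶠ v : HeightOneSpectrum (𝓞 K) in cofinite,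
      ∃ (ϖ : (v.adicCompletion K)ˣ) (α : Multiset ℂ),
        HasSatakeParameterAt P.1 (principalCongruenceLevel 2 K 𝔫₀) v ϖ α)
    (hQ : ∀ᶠ v : HeightOneSpectrum (𝓞 K) in cofinite,
      ∃ (ϖ' : (v.adicCompletion K)ˣ) (β : Multiset ℂ),
        HasSatakeParameterAt Q.1 (principalCongruenceLevel (m + 1) K 𝔑₀) v ϖ' β) :
    IsWeakSymmPowerLift m P.1 Q.1 ↔
      ∀ᶠ v : HeightOneSpectrum (𝓞 K) in cofinite,
        ∃ (ϖ ϖ' : (v.adicCompletion K)ˣ) (a b : ℂ),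
          HasSatakeParameterAt P.1 (principalCongruenceLevel 2 K 𝔫₀) v ϖ {a, b} ∧
            HasSatakeParameterAt Q.1 (principalCongruenceLevel (m + 1) K 𝔑₀) v ϖ'
              (symmPowerParams m a b) :=
  ⟨fun h => h.eventually_exists hP hQ,
    isWeakSymmPowerLift_of_eventually_exists hF₂ hF P Q h𝔫₀ h𝔑₀⟩

omit [(AdelicGroupData.gl (m + 1) K).IsAutomorphicMeasure ν] in
/-- **`Sym¹ π = π`.** A cuspidal automorphic representation `π` of `GL₂(𝔸_K)` is its own weak
first symmetric power lift (`Sym¹` is the standard representation, `symmPowerParams_one`):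
under `Flath1979_heckeOperatorAt_ofLocal_eq_smul`, Satake parameters of `π` at `v` read at two
levels `K(𝔫)`, `K(𝔑)` (`v ∤ 𝔫𝔑`, any eigenvectors and uniformizers) coincide
(`HasSatakeParameterAt.eq_of_ofLocal_eq_smul`). This is the case `n = 1` of Newton–Thorne's
Thm. A, trivially true. [cite: NewtonThorneIHES2021b, Thm. A (n = 1)] -/
theorem isWeakSymmPowerLift_one_self
    (hF₂ : Flath1979_heckeOperatorAt_ofLocal_eq_smul (n := 2) (K := K) (μ := μ))
    (P : CuspidalAutomorphicRepGL 2 K μ) : IsWeakSymmPowerLift 1 P.1 P.1 := by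
  intro 𝔫 𝔑
  obtain ⟨𝔫₁, h𝔫₁, h𝔫K⟩ := exists_ne_zero_principalCongruenceLevel_eq (n := 2) 𝔫
  obtain ⟨𝔑₁, h𝔑₁, h𝔑K⟩ := exists_ne_zero_principalCongruenceLevel_eq (n := 2) 𝔑
  have h1 : ∀ᶠ v : HeightOneSpectrum (𝓞 K) in cofinite, ¬ v.asIdeal ∣ 𝔫₁ :=
    (Ideal.finite_factors h𝔫₁).compl_mem_cofinite
  have h3 : ∀ᶠ v : HeightOneSpectrum (𝓞 K) in cofinite, ¬ v.asIdeal ∣ 𝔑₁ :=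
    (Ideal.finite_factors h𝔑₁).compl_mem_cofinite
  filter_upwards [h1, h3] with v hv1 hv3 ϖ ϖ' α β hα hβ a b hab
  rw [h𝔫K] at hα
  rw [h𝔑K] at hβ
  rw [symmPowerParams_one, ← hab]
  exact (HasSatakeParameterAt.eq_of_ofLocal_eq_smul hF₂ P h𝔫₁ h𝔑₁ hv1 hv3 hα hβ).symm

end Cuspidal

/-! ### Uniqueness of cuspidal weak symmetric power lifts -/

section Unique

variable {m}
variable {μ : Measure (AdelicGroupData.gl 2 K).automorphicQuotient}
  [SMulInvariantMeasure (AdelicGroupData.gl 2 K).Adelic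
    (AdelicGroupData.gl 2 K).automorphicQuotient μ]
  {ν : Measure (AdelicGroupData.gl (m + 1) K).automorphicQuotient}
  [(AdelicGroupData.gl (m + 1) K).IsAutomorphicMeasure ν]

/-- **Uniqueness of the cuspidal weak `Symᵐ`-lift** (`Symᵐ π` is "characterized" by the local
relation, Newton–Thorne II, §1 — for cuspidal lifts already by the relation at almost all
places, by strong multiplicity one). Let `π` be a closed subrepresentation of
`L²(GL₂(𝔸_K) ⧸ A_G GL₂(K))` having Satake parameters at some level `K(𝔫)` at all but finitely
many places (every cuspidal `π`, `exists_hasSatakeParameterAt_cofinite`), and let `Π, Π'` be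
*cuspidal* automorphic representations of `GL_{m+1}(𝔸_K)` (in the same `L²_cusp`) which are
both weak `Symᵐ`-lifts of `π`. Then `Π = Π'`, granted, on `GL_{m+1}` over `K`: strong
multiplicity one in Satake-parameter form (`Literature.NumberTheory.Automorphic.strong_multiplicity_one_gl`,
Jacquet–Shalika with multiplicity one) and the existence of Satake parameters at one level
almost everywhere (`exists_hasSatakeParameterAt_cofinite`). Proof, verbatim that of
`IsWeakBaseChangeLift.unique`: with levels `𝔑` of `Π` and `𝔑'` of `Π'`, at the common level
`K(𝔑𝔑')` (maximal at `v ∤ 𝔑𝔑'`) and outside the finite set `S` of bad places, `Π` and `Π'` have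
the same Satake parameters `t_{Π,v} = Symᵐ t_{π,v} = t_{Π',v}` (level transfer
`HasSatakeParameterAt.of_level_le`, independence of the uniformizer
`HasSatakeParameterAt.of_valuation_eq`); the non-vacuity guard of `strong_multiplicity_one_gl`
holds because `K` has infinitely many places (`infinite_heightOneSpectrum`).
[cite: NewtonThorneIHES2021b, §1 (p. 117)] -/
theorem IsWeakSymmPowerLift.unique
    (hSMO : strong_multiplicity_one_gl (n := m + 1) (K := K) (μ := ν))
    (hex : exists_hasSatakeParameterAt_cofinite (n := m + 1) (K := K) (μ := ν))
    {W : ContRepresentation.ClosedSubrep ((AdelicGroupData.gl 2 K).rightRegular μ)}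
    {𝔫 : Ideal (𝓞 K)}
    (hW : ∀ᶠ v : HeightOneSpectrum (𝓞 K) in cofinite,
      ∃ (ϖ : (v.adicCompletion K)ˣ) (α : Multiset ℂ),
        HasSatakeParameterAt W (principalCongruenceLevel 2 K 𝔫) v ϖ α)
    {Q Q' : CuspidalAutomorphicRepGL (m + 1) K ν}
    (hQ : IsWeakSymmPowerLift m W Q.1) (hQ' : IsWeakSymmPowerLift m W Q'.1) : Q = Q' := by
  haveI := infinite_heightOneSpectrum K
  obtain ⟨𝔑, h𝔑, hQs⟩ := hex Q
  obtain ⟨𝔑', h𝔑', hQ's⟩ := hex Q'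
  have h𝔐 : 𝔑 * 𝔑' ≠ 0 := mul_ne_zero h𝔑 h𝔑'
  have hfin : ∀ᶠ v : HeightOneSpectrum (𝓞 K) in cofinite, ¬ v.asIdeal ∣ 𝔑 * 𝔑' :=
    (Ideal.finite_factors h𝔐).compl_mem_cofinite
  -- the good places: everything holds
  have hG := (hW.and hfin).and ((hQs.and hQ's).and ((hQ 𝔫 (𝔑 * 𝔑')).and (hQ' 𝔫 (𝔑 * 𝔑'))))
  have hGfin := Filter.eventually_cofinite.mp hG
  set S : Finset (HeightOneSpectrum (𝓞 K)) := hGfin.toFinset with hS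
  have hgood : ∀ v ∉ S, _ := fun v (hv : v ∉ S) =>
    not_not.mp fun h => hv (hGfin.mem_toFinset.mpr h)
  -- at a good place, the Satake parameters of `Q` and `Q'` at level `K(𝔑𝔑')` agree
  have key : ∀ v ∉ S, ∀ (Q₁ Q₂ : CuspidalAutomorphicRepGL (m + 1) K ν) (𝔑₂ : Ideal (𝓞 K)),
      𝔑 * 𝔑' ≤ 𝔑₂ →
      (∃ (ϖ' : (v.adicCompletion K)ˣ) (β : Multiset ℂ),
        HasSatakeParameterAt Q₂.1 (principalCongruenceLevel (m + 1) K 𝔑₂) v ϖ' β) →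
      (∀ (ϖ ϖ' : (v.adicCompletion K)ˣ) (α β : Multiset ℂ),
        HasSatakeParameterAt W (principalCongruenceLevel 2 K 𝔫) v ϖ α →
          HasSatakeParameterAt Q₁.1 (principalCongruenceLevel (m + 1) K (𝔑 * 𝔑')) v ϖ' β →
            ∀ a b : ℂ, α = {a, b} → β = symmPowerParams m a b) →
      (∀ (ϖ ϖ' : (v.adicCompletion K)ˣ) (α β : Multiset ℂ),
        HasSatakeParameterAt W (principalCongruenceLevel 2 K 𝔫) v ϖ α →
          HasSatakeParameterAt Q₂.1 (principalCongruenceLevel (m + 1) K (𝔑 * 𝔑')) v ϖ' β →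
            ∀ a b : ℂ, α = {a, b} → β = symmPowerParams m a b) →
      ∀ (ϖ : (v.adicCompletion K)ˣ) (β : Multiset ℂ),
        HasSatakeParameterAt Q₁.1 (principalCongruenceLevel (m + 1) K (𝔑 * 𝔑')) v ϖ β →
          HasSatakeParameterAt Q₂.1 (principalCongruenceLevel (m + 1) K (𝔑 * 𝔑')) v ϖ β := by
    intro v hv Q₁ Q₂ 𝔑₂ hle hex₂ hrel₁ hrel₂ ϖ β hβ
    obtain ⟨⟨⟨ϖ₀, α, hα⟩, hv𝔐⟩, -⟩ := hgood v hv
    obtain ⟨a, b, rfl⟩ := exists_pair_of_hasSatakeParameterAt hα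
    obtain ⟨ϖ₂, β₂, hβ₂⟩ := hex₂
    have hβ₂' := hβ₂.of_level_le h𝔐 hle hv𝔐
    have e₁ := hrel₁ ϖ₀ ϖ _ β hα hβ a b rfl
    have e₂ := hrel₂ ϖ₀ ϖ₂ _ β₂ hα hβ₂' a b rfl
    rw [e₁, ← e₂]
    exact hβ₂'.of_valuation_eq (isMaximalAt_principalCongruenceLevel (m + 1) K v h𝔐 hv𝔐) hβ.1
  refine hSMO Q Q' S (principalCongruenceLevel (m + 1) K (𝔑 * 𝔑')) (fun v hv => ?_)
    (fun v hv ϖ β => ⟨fun hβ => ?_, fun hβ => ?_⟩) ?_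
  · exact isMaximalAt_principalCongruenceLevel (m + 1) K v h𝔐 (hgood v hv).1.2
  · obtain ⟨-, ⟨-, hQ'v⟩, hrel, hrel'⟩ := hgood v hv
    exact key v hv Q Q' 𝔑' Ideal.mul_le_left hQ'v hrel hrel' ϖ β hβ
  · obtain ⟨-, ⟨hQv, -⟩, hrel, hrel'⟩ := hgood v hv
    exact key v hv Q' Q 𝔑 Ideal.mul_le_right hQv hrel' hrel ϖ β hβ
  · obtain ⟨v, hv⟩ := hG.exists
    have hvS : v ∉ S := fun h => (hGfin.mem_toFinset.mp h) hv
    obtain ⟨⟨-, hv𝔐⟩, ⟨⟨ϖ₁, β₁, hβ₁⟩, -⟩, -⟩ := hv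
    exact ⟨v, hvS, ϖ₁, β₁, hβ₁.of_level_le h𝔐 Ideal.mul_le_right hv𝔐⟩

end Unique

end Lift

/-! ### Newforms and their automorphic representations (Gelbart, Thm. 5.19) -/

section Newform

variable {N : ℕ} [NeZero N] {k : ℤ}

section Def

variable {μ : Measure (AdelicGroupData.gl 2 ℚ).automorphicQuotient}
  [SMulInvariantMeasure (AdelicGroupData.gl 2 ℚ).Adelic
    (AdelicGroupData.gl 2 ℚ).automorphicQuotient μ]

/-- **`W` is the automorphic representation of the eigenform `f`** (the newform dictionary on
the tree's objects; Gelbart, *Automorphic forms on adele groups* (1975), Thm. 5.19 with Lemma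
5.16, (5.17)–(5.18); Bump, *Automorphic forms and representations* (1997), Thm. 3.6.1). For
`f ∈ S_k(Γ₁(N))` and a closed subrepresentation `W ≤ L²(GL₂(𝔸_ℚ) ⧸ A_G GL₂(ℚ))`: there is ONE
non-zero level `𝔫 ⊆ 𝓞 ℚ = ℤ` such that for all but finitely many finite places `v = p` of `ℚ`
(identified with primes by Mathlib's `Rat.HeightOneSpectrum.primesEquiv`), `p ∤ 𝔫` and `W` has,
with respect to the principal congruence subgroup `K(𝔫)` (which is `GL₂(ℤ_p)` at `p`), the
Satake parameter `{α, β}` at `p`, where `α + β = a_p(f) p^{-(k-1)/2}` and `αβ = χ_f(p)` for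
`a_p(f)` the `T_p`-eigenvalue (`heckeEigenvalue`) and `χ_f` the nebentypus (`nebentypus`) of
`f` — the unitarily normalised Satake pair of `f` at `p`: `{α, β} p^{(k-1)/2}` are the roots of
the Hecke polynomial `X² - a_p X + χ(p) p^{k-1}`. In the convention of `HasSatakeParameterAt`
(`T_{p,1} = [K diag(ϖ,1) K]`, `T_{p,2} = R(diag(ϖ,ϖ))` acting through the right regular
representation) this is Bump's computation for the representation `π_f` generated by the
adelisation `φ` of `f`: `φ` is an eigenfunction of `𝕋_p` with the eigenvalue `p^{1-k/2} a_p` of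
the classical Hecke operator and of `ℝ_p` with eigenvalue `χ(p)` (Bump, proof of Thm. 3.6.1,
p. 342), i.e. `p^{1/2}(α + β) = p^{1-k/2} a_p`, `αβ = χ(p)`; Gelbart's (5.18),
`C_p = p^{(k-1)/2}(p^{s₁} + p^{s₂})` with `μ_i = |·|^{s_i}`, `μ₁μ₂ = ψ_p`, displays the inverse
pair in his parametrisation `π(s₁, s₂)` (module docstring: the two readings differ by
`f ↦ f^ρ`, immaterial below). This is literally the clause of `exists_cuspidal_symmetricPower`
(`Sweep1`) at `m = 1` (`exists_cuspidal_symmetricPower_one`). For an irreducible cuspidal `W`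
it pins `W` down (strong multiplicity one); for `f` not an eigenform (`heckeEigenvalue` junk)
it is a junk notion. [cite: Gelbart1975, Thm. 5.19 and Lemma 5.16, (5.18)] -/
def IsAutomorphicRepOf (f : CuspForm (CongruenceSubgroup.Gamma1 N) k)
    (W : ContRepresentation.ClosedSubrep ((AdelicGroupData.gl 2 ℚ).rightRegular μ)) : Prop :=
  ∃ 𝔫 : Ideal (𝓞 ℚ), 𝔫 ≠ 0 ∧
    ∀ᶠ v : HeightOneSpectrum (𝓞 ℚ) in cofinite,
      ¬ v.asIdeal ∣ 𝔫 ∧ ∃ α β : ℂ,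
        α + β = heckeEigenvalue f (Rat.HeightOneSpectrum.primesEquiv v) /
            (((Real.sqrt (Rat.HeightOneSpectrum.primesEquiv v : ℕ) : ℝ) : ℂ) ^ (k - 1)) ∧
        α * β = nebentypus f (Rat.HeightOneSpectrum.primesEquiv v : ℕ) ∧
        ∃ ϖ : (v.adicCompletion ℚ)ˣ,
          HasSatakeParameterAt W (principalCongruenceLevel 2 ℚ 𝔫) v ϖ {α, β}

variable {W : ContRepresentation.ClosedSubrep ((AdelicGroupData.gl 2 ℚ).rightRegular μ)}
  {f : CuspForm (CongruenceSubgroup.Gamma1 N) k}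

/-- The automorphic representation of `f` has Satake parameters with respect to one non-zero
level `K(𝔫)` at all but finitely many places (forgetting their values; the shape consumed by
`IsWeakSymmPowerLift.eventually_exists` and `IsWeakSymmPowerLift.unique`). [folklore] -/
theorem IsAutomorphicRepOf.exists_eventually_hasSatakeParameterAt (h : IsAutomorphicRepOf f W) :
    ∃ 𝔫 : Ideal (𝓞 ℚ), 𝔫 ≠ 0 ∧ ∀ᶠ v : HeightOneSpectrum (𝓞 ℚ) in cofinite,
      ∃ (ϖ : (v.adicCompletion ℚ)ˣ) (α : Multiset ℂ),
        HasSatakeParameterAt W (principalCongruenceLevel 2 ℚ 𝔫) v ϖ α := by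
  obtain ⟨𝔫, h𝔫, h⟩ := h
  refine ⟨𝔫, h𝔫, ?_⟩
  filter_upwards [h] with v hv
  obtain ⟨-, α, β, -, -, ϖ, hϖ⟩ := hv
  exact ⟨ϖ, _, hϖ⟩

end Def

/-- **The cuspidal automorphic representation of a newform** (Gelbart, *Automorphic forms on
adele groups*, Ann. of Math. Stud. 83 (1975), §5, Thm. 5.19 with Lemma 5.16, (5.17)–(5.18);
Bump (1997), Thm. 3.6.1; Jacquet–Langlands). Let `f ∈ S_k(Γ₁(N))`, `k ≥ 2`, be a newform
(`IsNewform1`: a normalised Hecke eigenform in the new subspace, eigenvector of the diamond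
operators, with nebentypus `χ = nebentypus f`). Then there are an automorphic measure `μ` and a
cuspidal automorphic representation `π_f` of `GL₂(𝔸_ℚ)` — an irreducible closed subspace of
`L²_cusp(GL₂(𝔸_ℚ) ⧸ A_G GL₂(ℚ))` (`CuspidalAutomorphicRepGL`) — which is the automorphic
representation of `f` (`IsAutomorphicRepOf`): at one level `K(𝔫)`, `𝔫 ≠ 0` (namely `𝔫 = (N)`)
and all but finitely many `p`, `π_f` has the unitary Satake pair `{α, β}` of `f`,
`α + β = a_p p^{-(k-1)/2}`, `αβ = χ(p)`. Printed statements: Gelbart, Thm. 5.19 (a): for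
`f ∈ S_k(N, ψ)` an eigenfunction of the `T(p)`, `p ∤ N`, the representation `π_f` of `G_𝔸` on
the translates of `φ_f(g) = f(g_∞(i)) j(g_∞, i)^{-k} ψ(k₀)` in `L²₀(G_ℚ \ G_𝔸, ψ)` (`ψ` trivial on
`ℝ₊ˣ`, so inside the tree's `L²(GL₂(𝔸) ⧸ A_G GL₂(ℚ))`) is irreducible, and (p. 62) its
`p`-component for `p ∤ N` is the class-1 representation `π_p(μ₁, μ₂)` with `μ₁μ₂ = ψ_p` and
`T(p)`-eigenvalue `a_p = p^{(k-1)/2}(p^{s₁} + p^{s₂})` (Lemma 5.16, (5.18)); `φ_f` is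
`K(N)`-fixed and cuspidal, `π_∞` is the discrete series of weight `k ≥ 2` (Lemma 5.16 (3)).
The Hecke-operator convention of `HasSatakeParameterAt` and its effect (`π_f` versus `π_{f^ρ}`)
are discussed in the docstring of `IsAutomorphicRepOf` and the module docstring; the statement
holds under either reading. Weight one (Deligne–Serre; `π_∞` a limit of discrete series) is
classical too but not asserted. Not provable on the present tree (no adelisation of modular
forms, no class-1 theory `π(μ₁, μ₂)`); the `m = 1` case of lang.S24.
[cite: Gelbart1975, Thm. 5.19 and Lemma 5.16, (5.18)] [cite: Bump1997, Thm. 3.6.1] -/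
def Gelbart1975_exists_isAutomorphicRepOf : Prop :=
  ∀ (_hk : 2 ≤ k) {f : CuspForm (CongruenceSubgroup.Gamma1 N) k} (_hf : IsNewform1 f),
    ∃ (μ : Measure (AdelicGroupData.gl 2 ℚ).automorphicQuotient)
      (_ : (AdelicGroupData.gl 2 ℚ).IsAutomorphicMeasure μ) (P : CuspidalAutomorphicRepGL 2 ℚ μ),
      IsAutomorphicRepOf f P.1

/-- **Newton–Thorne: symmetric power functoriality for non-CM holomorphic newforms**
(J. Newton, J. A. Thorne, *Symmetric power functoriality for holomorphic modular forms, II*,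
Publ. Math. IHÉS 134 (2021), Thm. A, p. 117 (= Thm. 3.1, p. 139); with part I, ibid. 1–116,
Thm. 2, as the base case of its proof). Printed statement: *Let `π` be a regular algebraic,
cuspidal automorphic representation of `GL₂(𝔸_ℚ)`. Suppose that `π` is non-CM. Then for each
integer `n ≥ 1`, `Symⁿ π` exists, as a regular algebraic, cuspidal automorphic representation
of `GL_{n+1}(𝔸_ℚ)`*, where `Symⁿ π` is "characterized by the requirement that for any place `v`,
the Langlands parameter of `(Symⁿ π)_v` is the image of the Langlands parameter of `π_v` under
`Symⁿ : GL₂ → GL_{n+1}`" (§1, p. 117), "`π` regular algebraic" meaning that "`π` corresponds to a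
twist of a cuspidal Hecke eigenform `f` of weight `k ≥ 2`" (p. 117, [Gel75, §3]) and "non-CM"
that there is no quadratic Hecke character `χ` with `π ≅ π ⊗ χ` (part I, Thm. 2, footnote).
Read on the tree's objects: let `f ∈ S_k(Γ₁(N))`, `k ≥ 2`, be a newform without complex
multiplication (`¬ IsCMForm f`, Ribet's formulation: no Dirichlet character `η ≠ 1` with
`η(p) a_p = a_p` for almost all `p`; equivalent for newforms, Ribet (1977), §3), let `P` be a
cuspidal automorphic representation of `GL₂(𝔸_ℚ)` (in `L²_cusp(GL₂(𝔸_ℚ) ⧸ A_G GL₂(ℚ))` for an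
automorphic measure) which is the automorphic representation of `f` (`IsAutomorphicRepOf f P`:
the unitary twist of the source's `π`), and `m ≥ 1`. Then there are an automorphic measure `ν`
and a **cuspidal** automorphic representation `Q` of `GL_{m+1}(𝔸_ℚ)` which is a weak `m`-th
symmetric power lift of `P` (`IsWeakSymmPowerLift`: `t_{Q,p} = Symᵐ t_{P,p} = {αⁱ β^{m-i}}` for
almost all `p`) — namely `Q = Symᵐ π ⊗ |det|^{ms}` for `P ≅ π ⊗ |det|^{s}`, which is unitary
with central character `ω_P^{m(m+1)/2}` trivial on `A_G` (module docstring, *Unitary twist*).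
The characterisation at the ramified places and regular algebraicity of `Symᵐ π` are not
asserted (no local Langlands correspondence, no infinity types on the tree). The cases `k = 1`
or `f` CM are excluded as in the source (there `Symᵐ π` exists but is usually not cuspidal,
p. 118 and Thm. A.1). The lift is unique (`existsUnique_cuspidal_symmPowerLift`) and for
`m = 1` it is `P` itself (`exists_cuspidal_symmPowerLift_one`). Its proof (Thm. 2.1 and §3 of
the source on top of part I; module docstring) is far beyond the tree: named fact, not
discharged. [cite: NewtonThorneIHES2021b, Thm. A (= Thm. 3.1) and §1 (p. 117)]
[cite: NewtonThorneIHES2021a, Thm. 2] -/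
def NewtonThorne2021_exists_cuspidal_symmPowerLift : Prop :=
  ∀ (_hk : 2 ≤ k) {f : CuspForm (CongruenceSubgroup.Gamma1 N) k} (_hf : IsNewform1 f)
    (_hCM : ¬ IsCMForm f) (μ : Measure (AdelicGroupData.gl 2 ℚ).automorphicQuotient)
    [(AdelicGroupData.gl 2 ℚ).IsAutomorphicMeasure μ] (P : CuspidalAutomorphicRepGL 2 ℚ μ)
    (_hP : IsAutomorphicRepOf f P.1) {m : ℕ} (_hm : 1 ≤ m),
    ∃ (ν : Measure (AdelicGroupData.gl (m + 1) ℚ).automorphicQuotient)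
      (_ : (AdelicGroupData.gl (m + 1) ℚ).IsAutomorphicMeasure ν)
      (Q : CuspidalAutomorphicRepGL (m + 1) ℚ ν), IsWeakSymmPowerLift m P.1 Q.1

/-- **Assembly of lang.S24 from its first-layer facts.** The newform dictionary
(`Gelbart1975_exists_isAutomorphicRepOf`, Gelbart Thm. 5.19), Newton–Thorne's Thm. A in the
weak-lift form (`NewtonThorne2021_exists_cuspidal_symmPowerLift`) and "a cuspidal automorphic
representation of `GL_{m+1}(𝔸_ℚ)` has Satake parameters with respect to one level `K(𝔑)`,
`𝔑 ≠ 0`, at all but finitely many places" (`Literature.NumberTheory.Automorphic.exists_hasSatakeParameterAt_cofinite`,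
Flath / Borel–Jacquet §4.6, for every `m`) imply `exists_cuspidal_symmetricPower`: given a
non-CM newform `f` of weight `k ≥ 2` and `m ≥ 1`, take its cuspidal `P` with level `𝔫`, the
cuspidal weak `Symᵐ`-lift `Q` of `P` and a level `𝔑` of `Q`, and intersect four cofinite sets
of primes — `P` has the Satake pair `{α, β}` of `f` at `p` w.r.t. `K(𝔫)`, `Q` has a Satake
parameter `γ` at `p` w.r.t. `K(𝔑)`, `p ∤ 𝔑` (Mathlib `Ideal.finite_factors`), and the lift
relation at the levels `𝔫, 𝔑`, which forces `γ = {αⁱ β^{m-i}}`.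
[cite: NewtonThorneIHES2021b, Thm. A] -/
theorem exists_cuspidal_symmetricPower_of_symmPowerLift
    (hG : Gelbart1975_exists_isAutomorphicRepOf (N := N) (k := k))
    (hNT : NewtonThorne2021_exists_cuspidal_symmPowerLift (N := N) (k := k))
    (hS : ∀ (m : ℕ) (ν : Measure (AdelicGroupData.gl (m + 1) ℚ).automorphicQuotient)
      [(AdelicGroupData.gl (m + 1) ℚ).IsAutomorphicMeasure ν],
      exists_hasSatakeParameterAt_cofinite (n := m + 1) (K := ℚ) (μ := ν)) :
    exists_cuspidal_symmetricPower (N := N) (k := k) := by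
  intro hk f hf hCM m hm
  obtain ⟨μ, hμ, P, hP⟩ := hG hk hf
  obtain ⟨ν, hν, Q, hlift⟩ := hNT hk hf hCM μ P hP hm
  obtain ⟨𝔫, h𝔫, hPv⟩ := hP
  obtain ⟨𝔑, h𝔑, hQv⟩ := hS m ν Q
  refine ⟨ν, hν, Q, 𝔑, h𝔑, ?_⟩
  have h3 : ∀ᶠ v : HeightOneSpectrum (𝓞 ℚ) in cofinite, ¬ v.asIdeal ∣ 𝔑 :=
    (Ideal.finite_factors h𝔑).compl_mem_cofinite
  filter_upwards [hPv, hQv, h3, hlift 𝔫 𝔑] with v hv1 hv2 hv3 hv4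
  obtain ⟨-, α, β, hsum, hprod, ϖ, hα⟩ := hv1
  obtain ⟨ϖ', γ, hγ⟩ := hv2
  obtain rfl := hv4 ϖ ϖ' _ γ hα hγ α β rfl
  exact ⟨hv3, α, β, hsum, hprod, ϖ', hγ⟩

/-- **The case `m = 1` of lang.S24 is the newform dictionary.** From
`Gelbart1975_exists_isAutomorphicRepOf` alone, the clause of `exists_cuspidal_symmetricPower`
at `m = 1` holds: the cuspidal `π_f` has Satake parameter `{α⁰β¹, α¹β⁰} = {α, β}`
(`symmPowerParams_one`) at almost all `p` (Gelbart Thm. 5.19; `Sym¹ π_f = π_f`).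
[cite: Gelbart1975, Thm. 5.19] -/
theorem exists_cuspidal_symmetricPower_one
    (hG : Gelbart1975_exists_isAutomorphicRepOf (N := N) (k := k)) (hk : 2 ≤ k)
    {f : CuspForm (CongruenceSubgroup.Gamma1 N) k} (hf : IsNewform1 f) :
    ∃ (μ : Measure (AdelicGroupData.gl 2 ℚ).automorphicQuotient)
      (_ : (AdelicGroupData.gl 2 ℚ).IsAutomorphicMeasure μ)
      (P : CuspidalAutomorphicRepGL 2 ℚ μ) (𝔫 : Ideal (𝓞 ℚ)) (_ : 𝔫 ≠ 0),
      ∀ᶠ v : HeightOneSpectrum (𝓞 ℚ) in cofinite,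
        ¬ v.asIdeal ∣ 𝔫 ∧ ∃ α β : ℂ,
          α + β = heckeEigenvalue f (Rat.HeightOneSpectrum.primesEquiv v) /
              (((Real.sqrt (Rat.HeightOneSpectrum.primesEquiv v : ℕ) : ℝ) : ℂ) ^ (k - 1)) ∧
          α * β = nebentypus f (Rat.HeightOneSpectrum.primesEquiv v : ℕ) ∧
          ∃ ϖ : (v.adicCompletion ℚ)ˣ,
            HasSatakeParameterAt P.1 (principalCongruenceLevel 2 ℚ 𝔫) v ϖ
              ((Multiset.range 2).map fun i => α ^ i * β ^ (1 - i)) := by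
  obtain ⟨μ, hμ, P, 𝔫, h𝔫, hP⟩ := hG hk hf
  refine ⟨μ, hμ, P, 𝔫, h𝔫, ?_⟩
  filter_upwards [hP] with v hPv
  obtain ⟨hv, α, β, hsum, hprod, ϖ, hα⟩ := hPv
  refine ⟨hv, α, β, hsum, hprod, ϖ, ?_⟩
  rw [← symmPowerParams_def 1 α β, symmPowerParams_one]
  exact hα

/-- **The case `m = 1` of the Newton–Thorne fact holds: `Sym¹ P = P`.** Under
`Flath1979_heckeOperatorAt_ofLocal_eq_smul` for `GL₂` over `ℚ`, every cuspidal `P` on `GL₂(𝔸_ℚ)`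
has a cuspidal weak `Sym¹`-lift, namely itself (`isWeakSymmPowerLift_one_self`) — the
conclusion of `NewtonThorne2021_exists_cuspidal_symmPowerLift` at `m = 1`, for every `P`
(Newton–Thorne II, Thm. A with `n = 1`, trivially true). A consistency check on the shape of
the named fact. [cite: NewtonThorneIHES2021b, Thm. A (n = 1)] -/
theorem exists_cuspidal_symmPowerLift_one
    (hF₂ : ∀ (μ : Measure (AdelicGroupData.gl 2 ℚ).automorphicQuotient)
      [(AdelicGroupData.gl 2 ℚ).IsAutomorphicMeasure μ],
      Flath1979_heckeOperatorAt_ofLocal_eq_smul (n := 2) (K := ℚ) (μ := μ))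
    (μ : Measure (AdelicGroupData.gl 2 ℚ).automorphicQuotient)
    [(AdelicGroupData.gl 2 ℚ).IsAutomorphicMeasure μ] (P : CuspidalAutomorphicRepGL 2 ℚ μ) :
    ∃ (ν : Measure (AdelicGroupData.gl (1 + 1) ℚ).automorphicQuotient)
      (_ : (AdelicGroupData.gl (1 + 1) ℚ).IsAutomorphicMeasure ν)
      (Q : CuspidalAutomorphicRepGL (1 + 1) ℚ ν), IsWeakSymmPowerLift 1 P.1 Q.1 :=
  ⟨μ, inferInstance, P, isWeakSymmPowerLift_one_self (hF₂ μ) P⟩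

/-- **`Symᵐ π_f` is well defined** (Newton–Thorne II, Thm. A with §1: `Symᵐ π` is
"characterized" by the local relation). Granted the Newton–Thorne fact, the existence of Satake
parameters at one level almost everywhere (`exists_hasSatakeParameterAt_cofinite`) and strong
multiplicity one (`strong_multiplicity_one_gl`) for `GL_{m+1}` over `ℚ`: for `f` a non-CM
newform of weight `k ≥ 2`, `P` its cuspidal automorphic representation and `m ≥ 1`, there is an
automorphic measure `ν` for which `L²_cusp(GL_{m+1}(𝔸_ℚ) ⧸ A_G GL_{m+1}(ℚ))` contains EXACTLY ONE
cuspidal weak `Symᵐ`-lift of `P` (`IsWeakSymmPowerLift.unique`, with the Satake parameters of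
`P` provided by `IsAutomorphicRepOf.exists_eventually_hasSatakeParameterAt`).
[cite: NewtonThorneIHES2021b, Thm. A and §1 (p. 117)] -/
theorem existsUnique_cuspidal_symmPowerLift
    (hNT : NewtonThorne2021_exists_cuspidal_symmPowerLift (N := N) (k := k))
    (hS : ∀ (m : ℕ) (ν : Measure (AdelicGroupData.gl (m + 1) ℚ).automorphicQuotient)
      [(AdelicGroupData.gl (m + 1) ℚ).IsAutomorphicMeasure ν],
      exists_hasSatakeParameterAt_cofinite (n := m + 1) (K := ℚ) (μ := ν))
    (hSMO : ∀ (m : ℕ) (ν : Measure (AdelicGroupData.gl (m + 1) ℚ).automorphicQuotient)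
      [(AdelicGroupData.gl (m + 1) ℚ).IsAutomorphicMeasure ν],
      strong_multiplicity_one_gl (n := m + 1) (K := ℚ) (μ := ν))
    (hk : 2 ≤ k) {f : CuspForm (CongruenceSubgroup.Gamma1 N) k} (hf : IsNewform1 f)
    (hCM : ¬ IsCMForm f) (μ : Measure (AdelicGroupData.gl 2 ℚ).automorphicQuotient)
    [(AdelicGroupData.gl 2 ℚ).IsAutomorphicMeasure μ] (P : CuspidalAutomorphicRepGL 2 ℚ μ)
    (hP : IsAutomorphicRepOf f P.1) {m : ℕ} (hm : 1 ≤ m) :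
    ∃ (ν : Measure (AdelicGroupData.gl (m + 1) ℚ).automorphicQuotient)
      (_ : (AdelicGroupData.gl (m + 1) ℚ).IsAutomorphicMeasure ν),
      ∃! Q : CuspidalAutomorphicRepGL (m + 1) ℚ ν, IsWeakSymmPowerLift m P.1 Q.1 := by
  obtain ⟨ν, hν, Q, hQ⟩ := hNT hk hf hCM μ P hP hm
  obtain ⟨𝔫, -, hPv⟩ := hP.exists_eventually_hasSatakeParameterAt
  exact ⟨ν, hν, Q, hQ, fun Q' hQ' =>
    (IsWeakSymmPowerLift.unique (hSMO m ν) (hS m ν) hPv hQ hQ').symm⟩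

end Newform

end Literature.NumberTheory.Automorphic
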